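import Literature.MathematicalPhysics.QuantumFieldTheory.LatticeMaxwellBlockOU
import HarnessLib

/-!
# Stein's inverse operator `U_o`: second-order regularity and the `t`-derivative of the Gaussian
# interpolation (Meckes 2009, proofs of Lemma 1 (3) and Lemma 2)

Continuation of `LatticeMaxwellBlockOU.lean` (general layer `SteinOU`: a law `γ` on a real normed
space `E`, the interpolation `gaussInterp γ g t x = E g(√t x + √(1−t) Z)` and Stein's inverse
operator `steinInverse γ g = U_o g = ∫₀¹ (2t)⁻¹ [E g(Z_{x,t}) − E g(Z)] dt`). This file supplies the
two analytic ingredients of Meckes' proof of Lemma 1 (3) (Stein's equation) that are independent of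
Gaussianity, and the `C²` regularity of `U_o g` used by Lemma 2:

* `hasFDerivAt_fderiv_steinInverse_apply` — for `g ∈ C²` with bounded first and second derivative,
  every directional derivative `x ↦ D(U_o g)(x)[v]` is differentiable, with derivative
  `∫₀¹ (2t)⁻¹ √t · E[√t D(∂_v g)(Z_{x,t})] dt` ("by the formula for `U_o g`", differentiation under
  both integrals, dominated by `M₂(g)‖v‖/2`);
* `contDiff_two_steinInverse` — hence `U_o g ∈ C²` (finite-dimensional `E`);
* `hasDerivAt_gaussInterp` — for `t ∈ (0,1)`,
  `d/dt E g(Z_{x,t}) = E[Dg(Z_{x,t}) (x/(2√t) − Z/(2√(1−t)))]`;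
* `continuousOn_gaussInterp_Icc` and the fundamental-theorem-of-calculus form
  `sub_integral_eq_integral_Ioo_deriv_gaussInterp`:
  `g(x) − E g(Z) = ∫₀¹ E[Dg(Z_{x,t}) (x/(2√t) − Z/(2√(1−t)))] dt`.

Gaussian integration by parts turns the last integrand into `−(2t)⁻¹ (L G(t,·))(x)` for the
Ornstein–Uhlenbeck generator `L`; that step, and Stein's equation itself, are in
`LatticeMaxwellBlockSteinEquation.lean`.

References: E. Meckes, *On Stein's method for multivariate normal approximation*, IMS Collections 5
(2009) 153–178, arXiv:0902.0333, Lemma 1 (3) and Lemma 2 with their proofs [Meckes2009];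
S. Chatterjee, E. Meckes, ALEA 4 (2008) 257–283, arXiv:math/0701464, Lemma 2 [ChatterjeeMeckes2007].
-/

noncomputable section

open MeasureTheory ProbabilityTheory Filter Set
open scoped Topology

namespace Literature.MathematicalPhysics.QuantumFieldTheory

namespace SteinOU

variable {E : Type*} [NormedAddCommGroup E] [NormedSpace ℝ E] [MeasurableSpace E] [BorelSpace E]
  [SecondCountableTopology E] {γ : Measure E} [IsProbabilityMeasure γ] {g : E → ℝ} {C C₂ : ℝ}

/-! ### Directional derivatives of a `C²` observable -/

omit [MeasurableSpace E] [BorelSpace E] [SecondCountableTopology E] in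
/-- For `g ∈ C²`, each directional derivative `y ↦ Dg(y)[v]` is `C¹` (the regularity class of
Meckes' `M₂(g) < ∞`). [cite: Meckes2009, §1 (the quantities M_k(f))] -/
theorem contDiff_one_fderiv_apply (hg : ContDiff ℝ 2 g) (v : E) :
    ContDiff ℝ 1 (fun y => fderiv ℝ g y v) :=
  (hg.fderiv_right (m := 1) le_rfl).clm_apply contDiff_const

omit [MeasurableSpace E] [BorelSpace E] [SecondCountableTopology E] in
/-- The derivative of the directional derivative `y ↦ Dg(y)[v]` is `w ↦ D²g(y)[w][v]`.
[cite: Meckes2009, §1 (the quantities M_k(f))] -/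
theorem fderiv_fderiv_apply (hg : ContDiff ℝ 2 g) (v y w : E) :
    fderiv ℝ (fun y => fderiv ℝ g y v) y w = fderiv ℝ (fderiv ℝ g) y w v := by
  have hd : DifferentiableAt ℝ (fderiv ℝ g) y :=
    ((hg.fderiv_right (m := 1) le_rfl).differentiable one_ne_zero) y
  rw [fderiv_clm_apply hd (differentiableAt_const v)]
  simp

omit [MeasurableSpace E] [BorelSpace E] [SecondCountableTopology E] in
/-- `‖D(∂_v g)(y)‖ ≤ M₂(g) ‖v‖` when `‖D²g‖ ≤ M₂(g)` ("`M_k(f)` is the Lipschitz constant of the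
`k−1`-st derivative of `f`"). [cite: Meckes2009, §1 (the quantities M_k(f))] -/
theorem norm_fderiv_fderiv_apply_le (hg : ContDiff ℝ 2 g)
    (hC₂ : ∀ x, ‖fderiv ℝ (fderiv ℝ g) x‖ ≤ C₂) (v y : E) :
    ‖fderiv ℝ (fun y => fderiv ℝ g y v) y‖ ≤ C₂ * ‖v‖ := by
  have h0 : 0 ≤ C₂ := (norm_nonneg (fderiv ℝ (fderiv ℝ g) y)).trans (hC₂ y)
  refine ContinuousLinearMap.opNorm_le_bound _ (by positivity) fun w => ?_
  rw [fderiv_fderiv_apply hg]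
  calc ‖fderiv ℝ (fderiv ℝ g) y w v‖ ≤ ‖fderiv ℝ (fderiv ℝ g) y w‖ * ‖v‖ :=
        ContinuousLinearMap.le_opNorm _ _
    _ ≤ ‖fderiv ℝ (fderiv ℝ g) y‖ * ‖w‖ * ‖v‖ := by
        gcongr; exact ContinuousLinearMap.le_opNorm _ _
    _ ≤ C₂ * ‖w‖ * ‖v‖ := by gcongr; exact hC₂ y
    _ = C₂ * ‖v‖ * ‖w‖ := by ring

omit [MeasurableSpace E] [BorelSpace E] [SecondCountableTopology E] in
/-- `|Dg(y)[v]| ≤ M₁(g) ‖v‖` ("`M₁(f) = sup ‖Df‖_op`"). [cite: Meckes2009, §1 (the quantities M_k(f))] -/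
theorem abs_fderiv_apply_le (hC : ∀ x, ‖fderiv ℝ g x‖ ≤ C) (y v : E) :
    |fderiv ℝ g y v| ≤ C * ‖v‖ := by
  rw [← Real.norm_eq_abs]
  exact (ContinuousLinearMap.le_opNorm _ _).trans
    (mul_le_mul_of_nonneg_right (hC y) (norm_nonneg _))

omit [MeasurableSpace E] [BorelSpace E] [SecondCountableTopology E] in
/-- `‖D²g‖ = ‖iteratedFDeriv 2 g‖` pointwise: a bound on the second iterated derivative is a bound
`M₂` on the derivative of the derivative. [cite: Meckes2009, §1 (the quantities M_k(f))] -/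
theorem norm_fderiv_fderiv_le_of_iteratedFDeriv (hC₂ : ∀ x, ‖iteratedFDeriv ℝ 2 g x‖ ≤ C₂) (x : E) :
    ‖fderiv ℝ (fderiv ℝ g) x‖ ≤ C₂ := by
  have h := hC₂ x
  rwa [← norm_iteratedFDeriv_fderiv, ← norm_iteratedFDeriv_fderiv, norm_iteratedFDeriv_zero] at h

/-! ### Evaluating the derivative formulas -/

/-- `E[√t Dg(Z_{x,t})][v] = √t · E (∂_v g)(Z_{x,t})`: the derivative integrand evaluated at `v` is
the interpolation of the directional derivative. [cite: Meckes2009, proof of Lemma 2] -/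
theorem interpDeriv_apply (hg : ContDiff ℝ 1 g) (hC : ∀ x, ‖fderiv ℝ g x‖ ≤ C) (t : ℝ) (x v : E) :
    interpDeriv γ g t x v = Real.sqrt t * gaussInterp γ (fun y => fderiv ℝ g y v) t x := by
  rw [interpDeriv, ContinuousLinearMap.integral_apply (integrable_interpDeriv_integrand hg hC t x) v,
    gaussInterp, ← integral_const_mul]
  refine integral_congr_ae (Eventually.of_forall fun z => ?_)
  simp [smul_eq_mul]

/-- `D(U_o g)(x)[v] = ∫₀¹ (2t)⁻¹ √t · E (∂_v g)(Z_{x,t}) dt` ("by the formula for `U_o g`").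
[cite: Meckes2009, proof of Lemma 2] -/
theorem fderiv_steinInverse_apply (hg : ContDiff ℝ 1 g) (hC : ∀ x, ‖fderiv ℝ g x‖ ≤ C)
    (hγ : Integrable (fun z : E => ‖z‖) γ) (x v : E) :
    fderiv ℝ (steinInverse γ g) x v =
      ∫ t in Set.Ioo (0 : ℝ) 1,
        (2 * t)⁻¹ * (Real.sqrt t * gaussInterp γ (fun y => fderiv ℝ g y v) t x) := by
  rw [(hasFDerivAt_steinInverse hg hC hγ x).fderiv, steinInverseDeriv,
    ContinuousLinearMap.integral_apply (integrableOn_steinInverseDeriv_integrand hg hC x) v]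
  refine integral_congr_ae (Eventually.of_forall fun t => ?_)
  simp only [smul_apply, smul_eq_mul]
  rw [interpDeriv_apply hg hC]

/-! ### Second-order regularity of `U_o g` (Meckes 2009, Lemma 2 (1), `k = 2`, regularity part) -/

section SecondOrder

omit [MeasurableSpace E] [BorelSpace E] [SecondCountableTopology E] in
/-- `∂_v g` is `M₂‖v‖`-Lipschitz. [folklore] -/
private theorem lipschitz_dir (hg : ContDiff ℝ 2 g)
    (hC₂ : ∀ x, ‖fderiv ℝ (fderiv ℝ g) x‖ ≤ C₂) (v : E) :
    LipschitzWith (C₂ * ‖v‖).toNNReal (fun y => fderiv ℝ g y v) := by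
  refine lipschitzWith_of_nnnorm_fderiv_le
    ((contDiff_one_fderiv_apply hg v).differentiable one_ne_zero) fun y => ?_
  rw [← NNReal.coe_le_coe, coe_nnnorm]
  exact (norm_fderiv_fderiv_apply_le hg hC₂ v y).trans (Real.le_coe_toNNReal _)

omit [BorelSpace E] [SecondCountableTopology E] [IsProbabilityMeasure γ] in
/-- `|E (∂_v g)(Z_{x,t})| ≤ M₁‖v‖`. [folklore] -/
private theorem abs_gaussInterp_dir_le [IsProbabilityMeasure γ] (hC : ∀ x, ‖fderiv ℝ g x‖ ≤ C)
    (x v : E) (t : ℝ) :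
    |gaussInterp γ (fun y => fderiv ℝ g y v) t x| ≤ C * ‖v‖ := by
  rw [gaussInterp]
  have h := norm_integral_le_of_norm_le_const (μ := γ)
    (f := fun z => fderiv ℝ g (Real.sqrt t • x + Real.sqrt (1 - t) • z) v)
    (Eventually.of_forall fun z => by
      rw [Real.norm_eq_abs]; exact abs_fderiv_apply_le hC _ v)
  rw [Real.norm_eq_abs] at h
  simpa using h

/-- **The directional derivatives of `U_o g` are differentiable**: for `g ∈ C²` with
`‖Dg‖ ≤ M₁`, `‖D²g‖ ≤ M₂` and a probability law `γ` with a first moment,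
`x ↦ D(U_o g)(x)[v]` has derivative `∫₀¹ (2t)⁻¹ √t · E[√t D(∂_v g)(Z_{x,t})] dt` — differentiation
under the `dt`- and the `dγ`-integral, dominated by `M₂‖v‖/2` ("`∂h/∂xᵢ(x) = ∫₀¹ (2t)⁻¹ t^{1/2}
E[∂ᵢg(Z_{x,t})] dt`", differentiated once more). [cite: Meckes2009, proof of Lemma 2] -/
theorem hasFDerivAt_fderiv_steinInverse_apply (hg : ContDiff ℝ 2 g) (hC : ∀ x, ‖fderiv ℝ g x‖ ≤ C)
    (hC₂ : ∀ x, ‖fderiv ℝ (fderiv ℝ g) x‖ ≤ C₂) (hγ : Integrable (fun z : E => ‖z‖) γ) (v x₀ : E) :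
    HasFDerivAt (fun x => fderiv ℝ (steinInverse γ g) x v)
      (∫ t in Set.Ioo (0 : ℝ) 1,
        ((2 * t)⁻¹ * Real.sqrt t) • interpDeriv γ (fun y => fderiv ℝ g y v) t x₀) x₀ := by
  have hg1 : ContDiff ℝ 1 g := hg.of_le one_le_two
  have hgv : ContDiff ℝ 1 (fun y => fderiv ℝ g y v) := contDiff_one_fderiv_apply hg v
  have hCv : ∀ y, ‖fderiv ℝ (fun y => fderiv ℝ g y v) y‖ ≤ C₂ * ‖v‖ :=
    norm_fderiv_fderiv_apply_le hg hC₂ v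
  have hfun : (fun x => fderiv ℝ (steinInverse γ g) x v) = fun x =>
      ∫ t in Set.Ioo (0 : ℝ) 1,
        (2 * t)⁻¹ * (Real.sqrt t * gaussInterp γ (fun y => fderiv ℝ g y v) t x) := by
    funext x; exact fderiv_steinInverse_apply hg1 hC hγ x v
  rw [hfun]
  have hmeas : ∀ x, AEStronglyMeasurable (fun t : ℝ =>
      (2 * t)⁻¹ * (Real.sqrt t * gaussInterp γ (fun y => fderiv ℝ g y v) t x))
      (volume.restrict (Set.Ioo (0 : ℝ) 1)) := fun x =>
    (((measurable_const.mul measurable_id).inv).mul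
      ((Real.continuous_sqrt.measurable).mul
        (measurable_gaussInterp (lipschitz_dir hg hC₂ v) x))).aestronglyMeasurable
  refine hasFDerivAt_integral_of_dominated_of_fderiv_le
    (μ := volume.restrict (Set.Ioo (0 : ℝ) 1)) (s := Set.univ)
    (F := fun x t => (2 * t)⁻¹ * (Real.sqrt t * gaussInterp γ (fun y => fderiv ℝ g y v) t x))
    (F' := fun x t => ((2 * t)⁻¹ * Real.sqrt t) • interpDeriv γ (fun y => fderiv ℝ g y v) t x)
    (bound := fun _ => C₂ * ‖v‖ / 2) Filter.univ_mem
    (Eventually.of_forall hmeas) ?_ ?_ ?_ ?_ ?_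
  · -- integrability of the integrand at `x₀`: dominated by `C‖v‖/2 · t^{-1/2}`
    have hrpow : IntegrableOn (fun t : ℝ => t ^ (-(1 / 2 : ℝ))) (Set.Ioo (0 : ℝ) 1) := by
      have h := intervalIntegral.intervalIntegrable_rpow' (a := (0 : ℝ)) (b := 1)
        (r := -(1 / 2 : ℝ)) (by norm_num)
      rwa [intervalIntegrable_iff_integrableOn_Ioo_of_le zero_le_one] at h
    refine Integrable.mono' (hrpow.const_mul (C * ‖v‖ / 2)) (hmeas x₀) ?_
    rw [ae_restrict_iff' measurableSet_Ioo]
    refine Eventually.of_forall fun t ht => ?_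
    obtain ⟨ht0, ht1⟩ := ht
    have hsq : Real.sqrt t = t * t ^ (-(1 / 2 : ℝ)) := by
      rw [Real.sqrt_eq_rpow, show (-(1 / 2 : ℝ)) = (1 / 2 : ℝ) - 1 by norm_num,
        Real.rpow_sub_one ht0.ne']
      field_simp
    rw [Real.norm_eq_abs, abs_mul, abs_mul, abs_inv, abs_of_pos (by linarith : (0 : ℝ) < 2 * t),
      abs_of_nonneg (Real.sqrt_nonneg _)]
    calc (2 * t)⁻¹ * (Real.sqrt t * |gaussInterp γ (fun y => fderiv ℝ g y v) t x₀|)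
        ≤ (2 * t)⁻¹ * (Real.sqrt t * (C * ‖v‖)) := by
          gcongr; exact abs_gaussInterp_dir_le hC x₀ v t
      _ = C * ‖v‖ / 2 * t ^ (-(1 / 2 : ℝ)) := by rw [hsq]; field_simp
  · exact ((((measurable_const.mul measurable_id).inv).mul
      Real.continuous_sqrt.measurable).stronglyMeasurable.smul
        (stronglyMeasurable_interpDeriv hgv x₀)).aestronglyMeasurable
  · rw [ae_restrict_iff' measurableSet_Ioo]
    refine Eventually.of_forall fun t ht x _ => ?_
    obtain ⟨ht0, ht1⟩ := ht
    rw [norm_smul, Real.norm_eq_abs, abs_mul, abs_inv, abs_of_pos (by linarith : (0 : ℝ) < 2 * t),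
      abs_of_nonneg (Real.sqrt_nonneg _)]
    calc (2 * t)⁻¹ * Real.sqrt t * ‖interpDeriv γ (fun y => fderiv ℝ g y v) t x‖
        ≤ (2 * t)⁻¹ * Real.sqrt t * (Real.sqrt t * (C₂ * ‖v‖)) :=
          mul_le_mul_of_nonneg_left (norm_interpDeriv_le hCv t x) (by positivity)
      _ = C₂ * ‖v‖ / 2 := by
          rw [show (2 * t)⁻¹ * Real.sqrt t * (Real.sqrt t * (C₂ * ‖v‖)) =
            (2 * t)⁻¹ * (Real.sqrt t * Real.sqrt t) * (C₂ * ‖v‖) by ring,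
            Real.mul_self_sqrt ht0.le]
          field_simp
  · exact integrable_const _
  · refine Eventually.of_forall fun t x _ => ?_
    have h := ((hasFDerivAt_gaussInterp hgv hCv hγ t x).const_mul (Real.sqrt t)).const_mul
      ((2 * t)⁻¹)
    simpa only [smul_smul] using h

/-- The derivative of `x ↦ D(U_o g)(x)[v]` is continuous (dominated convergence twice: `D²g` is
continuous and bounded). [cite: Meckes2009, proof of Lemma 2] -/
theorem continuous_integral_interpDeriv_dir (hg : ContDiff ℝ 2 g)
    (hC₂ : ∀ x, ‖fderiv ℝ (fderiv ℝ g) x‖ ≤ C₂) (v : E) :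
    Continuous fun x => ∫ t in Set.Ioo (0 : ℝ) 1,
      ((2 * t)⁻¹ * Real.sqrt t) • interpDeriv γ (fun y => fderiv ℝ g y v) t x := by
  have hgv : ContDiff ℝ 1 (fun y => fderiv ℝ g y v) := contDiff_one_fderiv_apply hg v
  have hCv : ∀ y, ‖fderiv ℝ (fun y => fderiv ℝ g y v) y‖ ≤ C₂ * ‖v‖ :=
    norm_fderiv_fderiv_apply_le hg hC₂ v
  -- continuity of `x ↦ E[√t D(∂_v g)(Z_{x,t})]` for each `t`
  have hinner : ∀ t : ℝ, Continuous fun x => interpDeriv γ (fun y => fderiv ℝ g y v) t x := by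
    intro t
    have hDc : Continuous (fderiv ℝ (fun y => fderiv ℝ g y v)) := hgv.continuous_fderiv one_ne_zero
    refine continuous_of_dominated (μ := γ)
      (F := fun x z => Real.sqrt t •
        fderiv ℝ (fun y => fderiv ℝ g y v) (Real.sqrt t • x + Real.sqrt (1 - t) • z))
      (bound := fun _ => Real.sqrt t * (C₂ * ‖v‖)) ?_ ?_ (integrable_const _) ?_
    · exact fun x => (integrable_interpDeriv_integrand hgv hCv t x).aestronglyMeasurable
    · refine fun x => Eventually.of_forall fun z => ?_
      rw [norm_smul, Real.norm_of_nonneg (Real.sqrt_nonneg _)]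
      exact mul_le_mul_of_nonneg_left (hCv _) (Real.sqrt_nonneg _)
    · refine Eventually.of_forall fun z => ?_
      exact (hDc.comp (by fun_prop : Continuous fun x : E =>
        Real.sqrt t • x + Real.sqrt (1 - t) • z)).const_smul (Real.sqrt t)
  refine continuous_of_dominated (μ := volume.restrict (Set.Ioo (0 : ℝ) 1))
    (F := fun x t => ((2 * t)⁻¹ * Real.sqrt t) • interpDeriv γ (fun y => fderiv ℝ g y v) t x)
    (bound := fun _ => C₂ * ‖v‖ / 2) ?_ ?_ (integrable_const _) ?_
  · exact fun x => ((((measurable_const.mul measurable_id).inv).mul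
      Real.continuous_sqrt.measurable).stronglyMeasurable.smul
        (stronglyMeasurable_interpDeriv hgv x)).aestronglyMeasurable
  · intro x
    rw [ae_restrict_iff' measurableSet_Ioo]
    refine Eventually.of_forall fun t ht => ?_
    obtain ⟨ht0, ht1⟩ := ht
    rw [norm_smul, Real.norm_eq_abs, abs_mul, abs_inv, abs_of_pos (by linarith : (0 : ℝ) < 2 * t),
      abs_of_nonneg (Real.sqrt_nonneg _)]
    calc (2 * t)⁻¹ * Real.sqrt t * ‖interpDeriv γ (fun y => fderiv ℝ g y v) t x‖
        ≤ (2 * t)⁻¹ * Real.sqrt t * (Real.sqrt t * (C₂ * ‖v‖)) :=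
          mul_le_mul_of_nonneg_left (norm_interpDeriv_le hCv t x) (by positivity)
      _ = C₂ * ‖v‖ / 2 := by
          rw [show (2 * t)⁻¹ * Real.sqrt t * (Real.sqrt t * (C₂ * ‖v‖)) =
            (2 * t)⁻¹ * (Real.sqrt t * Real.sqrt t) * (C₂ * ‖v‖) by ring,
            Real.mul_self_sqrt ht0.le]
          field_simp
  · exact Eventually.of_forall fun t => (hinner t).const_smul ((2 * t)⁻¹ * Real.sqrt t)

/-- **`U_o g ∈ C²`** for `g ∈ C²` with bounded first and second derivative, `γ` a probability law
with a first moment on a finite-dimensional `E` (the regularity behind Meckes' Lemma 2 (1), `k = 2`,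
and behind applying the generator `L` to `U_o g` in Lemma 1 (3)). [cite: Meckes2009, Lemma 2 (1)] -/
theorem contDiff_two_steinInverse [FiniteDimensional ℝ E] (hg : ContDiff ℝ 2 g) (hC : ∀ x, ‖fderiv ℝ g x‖ ≤ C)
    (hC₂ : ∀ x, ‖fderiv ℝ (fderiv ℝ g) x‖ ≤ C₂) (hγ : Integrable (fun z : E => ‖z‖) γ) : ContDiff ℝ 2 (steinInverse γ g) := by
  have hg1 : ContDiff ℝ 1 g := hg.of_le one_le_two
  rw [show (2 : WithTop ℕ∞) = 1 + 1 from rfl, contDiff_succ_iff_fderiv_apply]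
  refine ⟨fun x => (hasFDerivAt_steinInverse hg1 hC hγ x).differentiableAt, by simp, fun v => ?_⟩
  rw [contDiff_one_iff_hasFDerivAt]
  exact ⟨_, continuous_integral_interpDeriv_dir hg hC₂ v,
    fun x => hasFDerivAt_fderiv_steinInverse_apply hg hC hC₂ hγ v x⟩

/-- The derivative integrand of `x ↦ D(U_o g)(x)[v]` is integrable on `(0,1)` (bounded by
`M₂‖v‖/2`). [cite: Meckes2009, proof of Lemma 2] -/
theorem integrable_interpDeriv_dir (hg : ContDiff ℝ 2 g)
    (hC₂ : ∀ x, ‖fderiv ℝ (fderiv ℝ g) x‖ ≤ C₂) (v x : E) :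
    Integrable (fun t : ℝ => ((2 * t)⁻¹ * Real.sqrt t) •
      interpDeriv γ (fun y => fderiv ℝ g y v) t x) (volume.restrict (Set.Ioo (0 : ℝ) 1)) := by
  have hgv : ContDiff ℝ 1 (fun y => fderiv ℝ g y v) := contDiff_one_fderiv_apply hg v
  have hCv : ∀ y, ‖fderiv ℝ (fun y => fderiv ℝ g y v) y‖ ≤ C₂ * ‖v‖ :=
    norm_fderiv_fderiv_apply_le hg hC₂ v
  refine Integrable.mono' (integrable_const (C₂ * ‖v‖ / 2))
    ((((measurable_const.mul measurable_id).inv).mul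
      Real.continuous_sqrt.measurable).stronglyMeasurable.smul
        (stronglyMeasurable_interpDeriv hgv x)).aestronglyMeasurable ?_
  rw [ae_restrict_iff' measurableSet_Ioo]
  refine Eventually.of_forall fun t ht => ?_
  obtain ⟨ht0, ht1⟩ := ht
  rw [norm_smul, Real.norm_eq_abs, abs_mul, abs_inv, abs_of_pos (by linarith : (0 : ℝ) < 2 * t),
    abs_of_nonneg (Real.sqrt_nonneg _)]
  calc (2 * t)⁻¹ * Real.sqrt t * ‖interpDeriv γ (fun y => fderiv ℝ g y v) t x‖
      ≤ (2 * t)⁻¹ * Real.sqrt t * (Real.sqrt t * (C₂ * ‖v‖)) :=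
        mul_le_mul_of_nonneg_left (norm_interpDeriv_le hCv t x) (by positivity)
    _ = C₂ * ‖v‖ / 2 := by
        rw [show (2 * t)⁻¹ * Real.sqrt t * (Real.sqrt t * (C₂ * ‖v‖)) =
          (2 * t)⁻¹ * (Real.sqrt t * Real.sqrt t) * (C₂ * ‖v‖) by ring,
          Real.mul_self_sqrt ht0.le]
        field_simp

/-- **The second directional derivatives of `U_o g`**:
`∂_w ∂_v (U_o g)(x) = ∫₀¹ ½ · E (∂_w ∂_v g)(Z_{x,t}) dt` (the factor `(2t)⁻¹ · √t · √t = ½`).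
[cite: Meckes2009, proof of Lemma 2] -/
theorem fderiv_fderiv_steinInverse_apply (hg : ContDiff ℝ 2 g) (hC : ∀ x, ‖fderiv ℝ g x‖ ≤ C)
    (hC₂ : ∀ x, ‖fderiv ℝ (fderiv ℝ g) x‖ ≤ C₂) (hγ : Integrable (fun z : E => ‖z‖) γ) (v w x : E) :
    fderiv ℝ (fun x => fderiv ℝ (steinInverse γ g) x v) x w =
      ∫ t in Set.Ioo (0 : ℝ) 1,
        (1 / 2 : ℝ) * gaussInterp γ (fun y => fderiv ℝ (fun y => fderiv ℝ g y v) y w) t x := by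
  have hgv : ContDiff ℝ 1 (fun y => fderiv ℝ g y v) := contDiff_one_fderiv_apply hg v
  have hCv : ∀ y, ‖fderiv ℝ (fun y => fderiv ℝ g y v) y‖ ≤ C₂ * ‖v‖ :=
    norm_fderiv_fderiv_apply_le hg hC₂ v
  rw [(hasFDerivAt_fderiv_steinInverse_apply hg hC hC₂ hγ v x).fderiv,
    ContinuousLinearMap.integral_apply (integrable_interpDeriv_dir hg hC₂ v x) w,
    ← integral_Ioc_eq_integral_Ioo, ← integral_Ioc_eq_integral_Ioo]
  refine setIntegral_congr_fun measurableSet_Ioc fun t ht => ?_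
  obtain ⟨ht0, ht1⟩ := ht
  simp only [smul_apply, smul_eq_mul]
  rw [interpDeriv_apply hgv hCv, ← mul_assoc,
    show (2 * t)⁻¹ * Real.sqrt t * Real.sqrt t = 1 / 2 by
      rw [mul_assoc, Real.mul_self_sqrt ht0.le]; field_simp]

end SecondOrder


end SteinOU

end Literature.MathematicalPhysics.QuantumFieldTheory

end
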